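import Summits.QuantumFields.YangMills.Theorems.BalabanUVNodesN07DbarFrameTowerOfReads
import Summits.QuantumFields.YangMills.Theorems.BalabanUVNodesN07SplitClauseBoxesCubeDomains
import Summits.QuantumFields.YangMills.Theorems.UnitScaleTiltProp8IterPlaqSmallAllL
import Literature.MathematicalPhysics.QuantumFieldTheory.Balaban1983to89.Node00.TorusCoverLevels
import HarnessLib

/-!
# N07 [B11] (= [15] = [Balaban1985Variational]) Sect. F — MODULE 127: **THE PLAQUETTE LETTER OF THE `n`-FOLD AVERAGED FIELD ON THE BOX OF ONE LEVEL-`(n+1)` BLOCK, FROM THE FINE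
# PLAQUETTES UNDER THAT BLOCK** ([3] Prop. 1 ∕ Prop. 4, [6] Lemma 1, [15] (146): «averages of regular configurations are regular», LOCAL form, `SU(N)`, every `L`) — the Q4 supplier
# of the N05-REC → K0-road φ-junction (dag-n07-w3 g13, pub-ymgap bus 2026-08-30 01:17Z): MODULE 126's hypothesis `hplaq : PlaqSmallOn (boxPlaqs (L·t) (L·t + (L−1))) a W` at
# `W := M^n U` with `a ≈ 120(d−1)ℓ·L^{2n+1}·a₀`, `a₀` the FINE plaquette letter on the fine box under the block `castSite t` (the datum's row (17) at the region containing it)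

Cell `pub-ymgap`, seat `pub-ymgap-dag-n07-e` g32 (FAN-OUT §N07 row s3; LANE OWNER of the K0 road chart side).  `--kind proof --supports stmt-QuantumFields-20541 --as helper` (K0⁷);
count-neutral; THEOREMS ONLY (0 `def`); generic `P`, `SU(N)`.  [15] = [Balaban1985Variational]; [6] = [Balaban1985RegularSpaces]; [3] = [Balaban1985Averaging]; [I] = [Balaban1987RG1].

WHY.  The junction's (σ2) supplier (✓p754021 ∘ ✓p753816) needs, per tower level `n`, the pairwise ∕ small-diameter stair letters of `M^n(U^{w_s})` on the window blocks (MODULE 126,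
from the level-`n` PLAQUETTE letter of that field on the block's box) — and that plaquette letter, GEOMETRIC in `n` with an `n`-uniform constant.  The tree holds the multi-level
plaquette smallness of the (0.4)-descent only GLOBALLY and for `SU(2)` (✓`IterPlaqSmallAllL.plaqSmall_iter_allL`: `PlaqSmall a₀ U` on all of `T_η` ⊢ `PlaqSmall ((720dℓ+1)L^{2i}a₀) (M^iU)`),
while the datum's (17) is REGIONAL (`ε_n·η_n²`, `η_n = L^{−n}`).  THIS FILE gives the LOCAL `SU(N)` form by composing landed pieces: pv26's box axial gauge on the fine box
`[L^{n+1}t, L^{n+1}t + L^{n+1} − 1]` under the block (`dist1_gaugeAct_axialGauge_le_of_mem_boxBonds`: every fine bond under the block within `s₀ := (d−1)(L^{n+1}−1)·a₀` in that gauge),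
this lineage's local dictionary under a set of top sites (✓`…N07DbarFrameTowerOfReads.emlIterU_unitsField_eq_iter_of_reads_set` at `T := {castSite t}`: every `i`-bond under the block,
`i ≤ n+1`, of the averaged gauged field within `30ℓLⁱs₀`), `B10Eq6DensityLevel.dist1_plaqHol_le` (a plaquette is within the sum of its four bonds), and gauge covariance of the averages
(`T4Continuum.iter_gaugeAct` + ✓`IterPlaqSmallAllL.dist1_plaqHol_gaugeAct`: the plaquette variables of `M^n(U^g)` are those of `M^nU`).

WHAT IS PROVED (sorry-free; axioms standard).
§1 geometry: `mem_fineBox_of_iterBlockOf_eq` (a fine site whose `j`-block point is `castSite t` lies in the fine box `castSite '' [Lʲt, Lʲt + Lʲ − 1]`), `fineBox_nonwrapping`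
   (`Lʲ < N₀ = 2L^{m+K}`), `mem_boxBonds_of_iterBlockOf_eq` (a fine bond under the block is a box bond), `blockOf_castSite_of_mem_box` (a level-`n` site of the box `[L·t, L·t + L−1]`
   has block `castSite t`), `iterBlockOf_succ_eq_of_iterBlockOf_eq`.
§2 ★★ `exists_boxGauge_dist1_iter_bond_le_of_fineBoxPlaqs` — in the box gauge `g`, every `i`-bond (`i ≤ n+1`) under the block: `dist1 (M^i(U^g) b) ≤ 30ℓLⁱ·((d−1)(L^{n+1}−1)·a₀)`
   (reads in the box gauge + the local dictionary; bond variables are gauge dependent, so `g` is displayed).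
§3 ★★★ `dist1_plaqHol_iter_le_of_fineBoxPlaqs` — every level-`n` plaquette based in the box of the block: `dist1 (plaqHol (M^nU) p) ≤ 120ℓLⁿ·((d−1)(L^{n+1}−1)·a₀)`;
   ★★★ `plaqSmallOn_iter_block_of_fineBoxPlaqs` — `PlaqSmallOn (boxPlaqs (L·t) (L·t + (L−1))) a (M^nU)` for every `a` above that bound = MODULE 126's `hplaq` at `W := M^nU`.
HONEST SCOPE: elementary composition of landed bookkeeping ([3] Prop. 4's factorisation via ✓`Prop8Chart`, pv26's axial gauge); nothing of [15]∕[6]∕[3]∕[I] analysis asserted beyond the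
cited modules; which region index `r` of (17) feeds `a₀` at a given window block is the junction's cell dictionary, NOT decided here; `HThm4RecSym152PhiEG` ∕ `HThm4Rec*` CONDITIONAL,
inhabited by nobody; K0⁷ ∕ K1⁹ NOT closed; N07 NOT discharged; counts unmoved (typed 28∕28 · discharged 8∕28); one finite 𝕋⁴ programme at fixed ε — the route closes the conditional
finite-𝕋⁴ rung `BalabanLadder.UV` ONLY; the YM mass gap (Clay) is NOT proved by any of this; nothing continuum ∕ ℝ⁴ ∕ OS.  No `def`, no `instance`, no `notation`, no `sorry`.

References: [3] Prop. 1 (51) p. 26, Prop. 4 (134)–(135) p. 38, (11) p. 19; [6] (1.7) p. 77, Lemma 1 p. 79, (1.33)–(1.34) p. 82; [15] (2) p. 278, (17) p. 280, (146)–(147) p. 301;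
[I] (0.1) p. 251, (0.4) p. 253.
-/

set_option autoImplicit false

noncomputable section

open scoped BigOperators Matrix.Norms.L2Operator

namespace Summit.QuantumFields.YangMills.BalabanUVNodes.N07IterPlaquettesOfFineBoxPlaquettes

open Literature.MathematicalPhysics.QuantumFieldTheory.Balaban1983to89
open Literature.MathematicalPhysics.QuantumFieldTheory.Balaban1983to89.Node00
open T4Continuum (transfUp iter_gaugeAct)
open T4AxialGaugeSmallField (castSite castSite_apply castSite_add_e boxBonds boxPlaqs axialGauge dist1_gaugeAct_axialGauge_le_of_mem_boxBonds)
open B7Prop1Explicit (e e_apply)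
open B14DomainGeom (Pt)
open B5Eq118OneStroke (iterBlockOf iterBlockOf_succ iterBlockOf_zero)
open GaugeField (gaugeAct)
open ExpMeanLog (expMeanLogSU deltaSU)
open FederbushMean (dist1_SU_eq)
open BlockAveraging (blockAvg)
open Literature.MathematicalPhysics.QuantumLattice (blockMap)
open Summit.QuantumFields.YangMills.BalabanUVNodes.N07DbarFrameTowerOfReads (emlIterU_unitsField_eq_iter_of_reads_set)
open Summit.QuantumFields.YangMills.BalabanUVNodes.N07SplitClauseBoxesCubeDomains (exists_lift_of_iterBlockOf_eq bounds_of_blockMap_eq)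
open Summit.QuantumFields.YangMills.BalabanUVNodes.N07ShearSizeTopBox (mem_boxBonds_of_ends_mem_box)
open Summit.QuantumFields.YangMills.Theorems.IterPlaqSmallAllL (dist1_plaqHol_gaugeAct)

variable {P : Params} {N : ℕ} [NeZero N]

/-! ## §1  Geometry: the fine box under one block; its non-wrapping; bonds under the block are box bonds -/

/-- A fine site whose `j`-fold block point is `castSite t` lies in the fine box `castSite '' [Lʲ·t, Lʲ·t + (Lʲ − 1)]` (standing range `j ≤ m + K`; module 38's «the `ℤᵈ` block covers
the torus block exactly»). [cite: Balaban1985RegularSpaces, (1.4) p.77; Balaban1987RG1, (0.1) p.251] -/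
theorem mem_fineBox_of_iterBlockOf_eq {j : ℕ} (hj : j ≤ P.m + P.K) (t : Pt P.d) {x : Site P 0} (hx : iterBlockOf j x = castSite t) :
    x ∈ (castSite '' Set.Icc (fun i => (P.L : ℤ) ^ j * t i) (fun i => (P.L : ℤ) ^ j * t i + ((P.L : ℤ) ^ j - 1)) : Set (Site P 0)) := by
  obtain ⟨X, hX, hXx⟩ := exists_lift_of_iterBlockOf_eq hj hx
  exact ⟨X, ⟨fun i => (bounds_of_blockMap_eq hX i).1, fun i => (bounds_of_blockMap_eq hX i).2⟩, hXx⟩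

/-- The fine box under one block of level `j ≤ m + K` does not wrap: `Lʲ < N₀ = 2·L^{m+K}` (ym3-torus `Prop7CovWeightedRowBricks.pow_lt_sitesPerDir_zero`, re-derived inline to keep the
imports light). [cite: Balaban1987RG1, (0.1) p.251 (bookkeeping)] -/
theorem fineBox_nonwrapping {j : ℕ} (hj : j ≤ P.m + P.K) (t : Pt P.d) :
    ∀ κ : Fin P.d, ((P.L : ℤ) ^ j * t κ + ((P.L : ℤ) ^ j - 1)) + 1 - (P.L : ℤ) ^ j * t κ < (P.sitesPerDir 0 : ℤ) := by
  intro κ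
  have hN : P.L ^ j < P.sitesPerDir 0 := by
    have hL1 : 1 ≤ P.L := P.L_pos
    have hpow : P.L ^ j ≤ P.L ^ (P.m + P.K) := Nat.pow_le_pow_right hL1 hj
    rw [Params.sitesPerDir, Nat.sub_zero]
    have : 0 < P.L ^ (P.m + P.K) := Nat.pow_pos hL1
    omega
  have : ((P.L ^ j : ℕ) : ℤ) < (P.sitesPerDir 0 : ℤ) := by exact_mod_cast hN
  push_cast at this
  linarith

/-- A fine bond whose two `j`-block points are the block `castSite t` is a bond of the fine box under it. [cite: Balaban1985RegularSpaces, (1.4) p.77; Balaban1987RG1, (0.1) p.251] -/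
theorem mem_boxBonds_of_iterBlockOf_eq {j : ℕ} (hj : j ≤ P.m + P.K) (t : Pt P.d) {b : PBond P 0}
    (hs : iterBlockOf j b.src = castSite t) (ht : iterBlockOf j b.tgt = castSite t) :
    b ∈ (boxBonds (fun i => (P.L : ℤ) ^ j * t i) (fun i => (P.L : ℤ) ^ j * t i + ((P.L : ℤ) ^ j - 1)) : Set (PBond P 0)) :=
  mem_boxBonds_of_ends_mem_box (fineBox_nonwrapping hj t) (mem_fineBox_of_iterBlockOf_eq hj t hs) (mem_fineBox_of_iterBlockOf_eq hj t ht)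

/-- A level-`n` site of the box `[L·t, L·t + (L−1)]` has block point `castSite t` (standing range). [cite: Balaban1987RG1, (0.1)–(0.3) pp.251–252 (bookkeeping)] -/
theorem blockOf_castSite_of_mem_box {n : ℕ} (hn : n + 1 ≤ P.m + P.K) (t : Pt P.d) {w : Pt P.d}
    (hlo : (fun i => (P.L : ℤ) * t i) ≤ w) (hhi : w ≤ fun i => (P.L : ℤ) * t i + ((P.L : ℤ) - 1)) :
    blockOf (castSite w : Site P n) = (castSite t : Site P (n + 1)) := by
  change blockOf (coverAt P n w) = coverAt P (n + 1) t
  rw [blockOf_coverAt hn]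
  congr 1
  funext i
  have h1 := hlo i
  have h2 := hhi i
  simp only at h1 h2
  have hL : (0 : ℤ) < P.L := by exact_mod_cast P.L_pos
  show w i / (P.L : ℤ) = t i
  have hlt : w i < (P.L : ℤ) * t i + P.L := by linarith
  have hge : (P.L : ℤ) * t i ≤ w i := h1
  rw [Int.ediv_eq_iff_of_pos hL]
  constructor <;> linarith

/-- Under a block: if the `n`-block point of a fine site is `z` and `blockOf z = y` then its `(n+1)`-block point is `y`. [cite: Balaban1987RG1, (0.1) p.251 (bookkeeping)] -/
theorem iterBlockOf_succ_eq_of_iterBlockOf_eq {n : ℕ} {x : Site P 0} {z : Site P n} {y : Site P (n + 1)} (hx : iterBlockOf n x = z) (hz : blockOf z = y) :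
    iterBlockOf (n + 1) x = y := by
  rw [iterBlockOf_succ, hx, hz]

/-! ## §2  The bonds of the averages under one block, in the box gauge, from the fine plaquettes under it -/

/-- ★★ **IN pv26's BOX GAUGE OF THE FINE BOX UNDER ONE LEVEL-`(n+1)` BLOCK, THE `i`-BONDS OF THE AVERAGES UNDER THE BLOCK ARE NEAR `1`**, `i ≤ n+1`: if every fine plaquette of the
fine box under `castSite t` is within `a₀ ≥ 0` of `1` (`PlaqSmallOn S₀ a₀ U`, `boxPlaqs … ⊆ S₀`), with the budget `6400ℓ²L^{n+1}s₀ ≤ 1` and the (0.4) guard `30ℓ²L^{n+1}s₀ < δ_N` at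
`s₀ := (d−1)(L^{n+1}−1)·a₀`, then for the box gauge `g` every `i`-bond whose two ends lie under the block has `dist1 (M^i(U^g) b) ≤ 30ℓLⁱ·s₀` — [3] Prop. 4's factorisation
(✓`…N07DbarFrameTowerOfReads.emlIterU_unitsField_eq_iter_of_reads_set` at `T := {castSite t}`) on the reads `dist1_gaugeAct_axialGauge_le_of_mem_boxBonds`.  (Bond variables are gauge
DEPENDENT; the gauge-free statement is §3's, for plaquettes.) [cite: Balaban1985Averaging, Prop. 4 (134)–(135) p.38, (11) p.19; Balaban1985RegularSpaces, Lemma 1 p.79; Balaban1987RG1, (0.4) p.253] -/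
theorem exists_boxGauge_dist1_iter_bond_le_of_fineBoxPlaqs {n : ℕ} (hn : n + 1 ≤ P.m + P.K) (U : GaugeField P 0 (SU N)) {a₀ : ℝ} (ha₀ : 0 ≤ a₀) (t : Pt P.d)
    {S₀ : Set (Plaq P 0)} (hS₀ : boxPlaqs (fun i => (P.L : ℤ) ^ (n + 1) * t i) (fun i => (P.L : ℤ) ^ (n + 1) * t i + ((P.L : ℤ) ^ (n + 1) - 1)) ⊆ S₀)
    (hU : PlaqSmallOn S₀ a₀ U)
    (hbud : 6400 * (((P.d + 2) * P.L : ℕ) : ℝ) ^ 2 * (P.L : ℝ) ^ (n + 1) * ((((P.d - 1 : ℕ) : ℝ)) * (((P.L ^ (n + 1) - 1 : ℕ) : ℝ)) * a₀) ≤ 1)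
    (hgd : 30 * (((P.d + 2) * P.L : ℕ) : ℝ) ^ 2 * (P.L : ℝ) ^ (n + 1) * ((((P.d - 1 : ℕ) : ℝ)) * (((P.L ^ (n + 1) - 1 : ℕ) : ℝ)) * a₀) < deltaSU (Fin N)) :
    ∃ g : GaugeTransf P 0 (SU N), ∀ (i : ℕ), i ≤ n + 1 → ∀ b : PBond P i,
      (∀ x : Site P 0, iterBlockOf i x = b.src → iterBlockOf (n + 1) x = castSite t) → (∀ x : Site P 0, iterBlockOf i x = b.tgt → iterBlockOf (n + 1) x = castSite t) →
      dist1 (Averaging.iter (fun _ => blockAvg (expMeanLogSU (n := Fin N))) i (gaugeAct g U) b) ≤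
        30 * (((P.d + 2) * P.L : ℕ) : ℝ) * (P.L : ℝ) ^ i * ((((P.d - 1 : ℕ) : ℝ)) * (((P.L ^ (n + 1) - 1 : ℕ) : ℝ)) * a₀) := by
  classical
  set lo : Pt P.d := fun i => (P.L : ℤ) ^ (n + 1) * t i with hlo
  set hi' : Pt P.d := fun i => (P.L : ℤ) ^ (n + 1) * t i + ((P.L : ℤ) ^ (n + 1) - 1) with hhi
  set s₀ : ℝ := (((P.d - 1 : ℕ) : ℝ)) * (((P.L ^ (n + 1) - 1 : ℕ) : ℝ)) * a₀ with hs₀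
  have hs₀0 : 0 ≤ s₀ := by positivity
  -- pv26's box gauge on the fine box under the block
  set g : GaugeTransf P 0 (SU N) := axialGauge U lo hi' with hg
  have hL1 : 1 ≤ P.L := P.L_pos
  have hside : ∀ κ, hi' κ ≤ lo κ + ((P.L ^ (n + 1) - 1 : ℕ) : ℤ) := fun κ => by
    simp only [hhi, hlo]
    have h1 : 1 ≤ P.L ^ (n + 1) := Nat.one_le_pow _ _ hL1
    push_cast [Nat.cast_sub h1]
    linarith
  have hsideN : P.L ^ (n + 1) - 1 < P.sitesPerDir 0 := by
    have h := fineBox_nonwrapping hn t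
    have h1 : 1 ≤ P.L ^ (n + 1) := Nat.one_le_pow _ _ hL1
    -- `d ≥ 1`: read the non-wrapping row in direction `0`
    have hd : 0 < P.d := P.hd
    have h2 := h ⟨0, hd⟩
    have h3 : ((P.L ^ (n + 1) : ℕ) : ℤ) < (P.sitesPerDir 0 : ℤ) := by push_cast; linarith
    have h4 : P.L ^ (n + 1) < P.sitesPerDir 0 := by exact_mod_cast h3
    omega
  -- reads of `U^g` on the fine bonds under the block
  have hreads : ∀ b₀ : PBond P 0, iterBlockOf (n + 1) b₀.src ∈ ({castSite t} : Set (Site P (n + 1))) → iterBlockOf (n + 1) b₀.tgt ∈ ({castSite t} : Set (Site P (n + 1))) →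
      ‖((gaugeAct g U b₀ : SU N) : Matrix (Fin N) (Fin N) ℂ) - 1‖ ≤ s₀ := by
    intro b₀ hb₀s hb₀t
    rw [Set.mem_singleton_iff] at hb₀s hb₀t
    rw [← dist1_SU_eq]
    have h := dist1_gaugeAct_axialGauge_le_of_mem_boxBonds U hS₀ hU ha₀ hside hsideN (mem_boxBonds_of_iterBlockOf_eq hn t hb₀s hb₀t)
    rw [hs₀]
    exact h.trans (le_of_eq (by ring))
  refine ⟨g, fun i hi b hbs hbt => ?_⟩
  -- the local dictionary under `T := {castSite t}` for `U^g`
  have hdict := emlIterU_unitsField_eq_iter_of_reads_set hn ({castSite t} : Set (Site P (n + 1))) (gaugeAct g U) hs₀0 hbud hgd hreads i hi b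
    (fun x hx => by rw [Set.mem_singleton_iff]; exact hbs x hx) (fun x hx => by rw [Set.mem_singleton_iff]; exact hbt x hx)
  rw [dist1_SU_eq]
  exact hdict.2

/-! ## §3  The plaquettes of `M^nU` on the box of one block — gauge-free -/

/-- ★★★ **EVERY LEVEL-`n` PLAQUETTE BASED IN THE BOX OF THE BLOCK `castSite t` OF `M^nU` IS NEAR `1`**: under §2's hypotheses, `dist1 (plaqHol (M^nU) p) ≤ 120ℓLⁿ·((d−1)(L^{n+1}−1)·a₀)`
— the four bonds of `p` lie under the block (§1), each within `30ℓLⁿs₀` for the box-gauged field (§2), a plaquette is within the sum of its four bonds of `1`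
(`B10Eq6DensityLevel.dist1_plaqHol_le`), and the plaquette variables of `M^n(U^g) = (M^nU)^{g↑}` (`T4Continuum.iter_gaugeAct`) are those of `M^nU`
(✓`IterPlaqSmallAllL.dist1_plaqHol_gaugeAct`). [cite: Balaban1985Variational, (146) p.301, (17) p.280; Balaban1985Averaging, Prop. 4 p.38; Balaban1985RegularSpaces, (1.33)–(1.34) p.82; Balaban1987RG1, (0.4) p.253] -/
theorem dist1_plaqHol_iter_le_of_fineBoxPlaqs {n : ℕ} (hn : n + 1 ≤ P.m + P.K) (U : GaugeField P 0 (SU N)) {a₀ : ℝ} (ha₀ : 0 ≤ a₀) (t : Pt P.d)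
    {S₀ : Set (Plaq P 0)} (hS₀ : boxPlaqs (fun i => (P.L : ℤ) ^ (n + 1) * t i) (fun i => (P.L : ℤ) ^ (n + 1) * t i + ((P.L : ℤ) ^ (n + 1) - 1)) ⊆ S₀)
    (hU : PlaqSmallOn S₀ a₀ U)
    (hbud : 6400 * (((P.d + 2) * P.L : ℕ) : ℝ) ^ 2 * (P.L : ℝ) ^ (n + 1) * ((((P.d - 1 : ℕ) : ℝ)) * (((P.L ^ (n + 1) - 1 : ℕ) : ℝ)) * a₀) ≤ 1)
    (hgd : 30 * (((P.d + 2) * P.L : ℕ) : ℝ) ^ 2 * (P.L : ℝ) ^ (n + 1) * ((((P.d - 1 : ℕ) : ℝ)) * (((P.L ^ (n + 1) - 1 : ℕ) : ℝ)) * a₀) < deltaSU (Fin N))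
    (p : Plaq P n) (hp : p ∈ boxPlaqs (fun i => (P.L : ℤ) * t i) (fun i => (P.L : ℤ) * t i + ((P.L : ℤ) - 1))) :
    dist1 (GaugeField.plaqHol (Averaging.iter (fun _ => blockAvg (expMeanLogSU (n := Fin N))) n U) p) ≤
      120 * (((P.d + 2) * P.L : ℕ) : ℝ) * (P.L : ℝ) ^ n * ((((P.d - 1 : ℕ) : ℝ)) * (((P.L ^ (n + 1) - 1 : ℕ) : ℝ)) * a₀) := by
  obtain ⟨g, hg⟩ := exists_boxGauge_dist1_iter_bond_le_of_fineBoxPlaqs hn U ha₀ t hS₀ hU hbud hgd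
  -- the four corners of `p` have block point `castSite t`
  obtain ⟨z, hzlo, hzhi, hsrc⟩ := hp
  have hL1z : (1 : ℤ) ≤ (P.L : ℤ) := by exact_mod_cast P.L_pos
  have hL0 : (0 : ℤ) ≤ (P.L : ℤ) - 1 := by linarith
  have he0 : ∀ (κ : Fin P.d) (i : Fin P.d), (0 : ℤ) ≤ e κ i := fun κ i => by rw [e_apply]; split_ifs <;> norm_num
  have hc1 : blockOf (castSite z : Site P n) = (castSite t : Site P (n + 1)) :=
    blockOf_castSite_of_mem_box hn t hzlo (fun i => by have h1 := hzhi i; have h2 := he0 p.μ i; have h3 := he0 p.ν i; simp only [Pi.add_apply] at h1 ⊢; linarith)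
  have hc2 : blockOf (castSite (z + e p.μ) : Site P n) = (castSite t : Site P (n + 1)) :=
    blockOf_castSite_of_mem_box hn t (fun i => by have h1 := hzlo i; have h2 := he0 p.μ i; simp only [Pi.add_apply] at h1 ⊢; linarith)
      (fun i => by have h1 := hzhi i; have h3 := he0 p.ν i; simp only [Pi.add_apply] at h1 ⊢; linarith)
  have hc3 : blockOf (castSite (z + e p.ν) : Site P n) = (castSite t : Site P (n + 1)) :=
    blockOf_castSite_of_mem_box hn t (fun i => by have h1 := hzlo i; have h2 := he0 p.ν i; simp only [Pi.add_apply] at h1 ⊢; linarith)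
      (fun i => by have h1 := hzhi i; have h3 := he0 p.μ i; simp only [Pi.add_apply] at h1 ⊢; linarith)
  have hc4 : blockOf (castSite (z + e p.μ + e p.ν) : Site P n) = (castSite t : Site P (n + 1)) :=
    blockOf_castSite_of_mem_box hn t (fun i => by have h1 := hzlo i; have h2 := he0 p.μ i; have h3 := he0 p.ν i; simp only [Pi.add_apply] at h1 ⊢; linarith) hzhi
  -- in torus letters
  have hs1 : p.src = castSite z := hsrc
  have hs2 : p.src.shift p.μ = castSite (z + e p.μ) := by rw [castSite_add_e, hs1]
  have hs3 : p.src.shift p.ν = castSite (z + e p.ν) := by rw [castSite_add_e, hs1]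
  have hs4 : (p.src.shift p.μ).shift p.ν = castSite (z + e p.μ + e p.ν) := by rw [castSite_add_e, hs2]
  have hs4' : (p.src.shift p.ν).shift p.μ = castSite (z + e p.μ + e p.ν) := by
    rw [add_right_comm, castSite_add_e, hs3]
  -- the under-the-block conditions of the four bonds
  have under : ∀ w : Site P n, blockOf w = (castSite t : Site P (n + 1)) → ∀ x : Site P 0, iterBlockOf n x = w → iterBlockOf (n + 1) x = castSite t :=
    fun w hw x hx => iterBlockOf_succ_eq_of_iterBlockOf_eq hx hw
  have u1 := under _ (hs1 ▸ hc1)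
  have u2 := under _ (hs2 ▸ hc2)
  have u3 := under _ (hs3 ▸ hc3)
  have u4 := under _ (hs4 ▸ hc4)
  have u4' := under _ (hs4' ▸ hc4)
  set W := Averaging.iter (fun _ => blockAvg (expMeanLogSU (n := Fin N))) n (gaugeAct g U) with hW
  have h1 := hg n (Nat.le_succ n) ⟨p.src, p.μ⟩ u1 u2
  have h2 := hg n (Nat.le_succ n) ⟨p.src.shift p.μ, p.ν⟩ u2 u4
  have h3 := hg n (Nat.le_succ n) ⟨p.src.shift p.ν, p.μ⟩ u3 u4'
  have h4 := hg n (Nat.le_succ n) ⟨p.src, p.ν⟩ u1 u3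
  -- covariance: the plaquettes of `M^n(U^g)` are those of `M^nU`
  have hcov : W = gaugeAct (transfUp g n) (Averaging.iter (fun _ => blockAvg (expMeanLogSU (n := Fin N))) n U) :=
    iter_gaugeAct _ g n (Nat.le_of_succ_le hn) U
  rw [← dist1_plaqHol_gaugeAct (transfUp g n), ← hcov]
  refine (B10Eq6DensityLevel.dist1_plaqHol_le W p).trans ?_
  have hsum := add_le_add (add_le_add (add_le_add h1 h2) h3) h4
  refine hsum.trans (le_of_eq ?_)
  ring

/-- ★★★ **MODULE 126's `hplaq` AT `W := M^nU`, FROM THE FINE PLAQUETTES UNDER THE BLOCK**: under §2's hypotheses, for every `a` with `120ℓLⁿ·((d−1)(L^{n+1}−1)·a₀) < a`: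
`PlaqSmallOn (boxPlaqs (L·t) (L·t + (L−1))) a (M^nU)`.  (For `M^n(U^w)`, any `w`, the same by `iter_gaugeAct` + `dist1_plaqHol_gaugeAct`.) With the datum's (17) at the region
index `r` holding the fine box (`a₀ := ε_r·L^{−2r}`) the letter is `≈ 120(d−1)ℓL·ε_r·L^{2(n−r)}` — geometric in `n`, `n`-uniform constant.
[cite: Balaban1985Variational, (17) p.280, (146) p.301; Balaban1985RegularSpaces, (1.7) p.77, (1.33)–(1.34) p.82; Balaban1985Averaging, Prop. 4 p.38] -/
theorem plaqSmallOn_iter_block_of_fineBoxPlaqs {n : ℕ} (hn : n + 1 ≤ P.m + P.K) (U : GaugeField P 0 (SU N)) {a₀ : ℝ} (ha₀ : 0 ≤ a₀) (t : Pt P.d)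
    {S₀ : Set (Plaq P 0)} (hS₀ : boxPlaqs (fun i => (P.L : ℤ) ^ (n + 1) * t i) (fun i => (P.L : ℤ) ^ (n + 1) * t i + ((P.L : ℤ) ^ (n + 1) - 1)) ⊆ S₀)
    (hU : PlaqSmallOn S₀ a₀ U)
    (hbud : 6400 * (((P.d + 2) * P.L : ℕ) : ℝ) ^ 2 * (P.L : ℝ) ^ (n + 1) * ((((P.d - 1 : ℕ) : ℝ)) * (((P.L ^ (n + 1) - 1 : ℕ) : ℝ)) * a₀) ≤ 1)
    (hgd : 30 * (((P.d + 2) * P.L : ℕ) : ℝ) ^ 2 * (P.L : ℝ) ^ (n + 1) * ((((P.d - 1 : ℕ) : ℝ)) * (((P.L ^ (n + 1) - 1 : ℕ) : ℝ)) * a₀) < deltaSU (Fin N))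
    {a : ℝ} (ha : 120 * (((P.d + 2) * P.L : ℕ) : ℝ) * (P.L : ℝ) ^ n * ((((P.d - 1 : ℕ) : ℝ)) * (((P.L ^ (n + 1) - 1 : ℕ) : ℝ)) * a₀) < a) :
    PlaqSmallOn (boxPlaqs (fun i => (P.L : ℤ) * t i) (fun i => (P.L : ℤ) * t i + ((P.L : ℤ) - 1)))
      a (Averaging.iter (fun _ => blockAvg (expMeanLogSU (n := Fin N))) n U) :=
  fun p hp => (dist1_plaqHol_iter_le_of_fineBoxPlaqs hn U ha₀ t hS₀ hU hbud hgd p hp).trans_lt ha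

end Summit.QuantumFields.YangMills.BalabanUVNodes.N07IterPlaquettesOfFineBoxPlaquettes

end
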